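import Mathlib.LinearAlgebra.Matrix.ToLinearEquiv
import Mathlib.Data.Matrix.ColumnRowPartitioned
import Literature.Algebra.EuclideanLattices.KhotTensorBoost
import Literature.Algebra.EuclideanLattices.Problems
import Literature.Algebra.EuclideanLattices.LatticeProblemsProofs
import HarnessLib

/-!
# From integer column bases to `GapSVP` instances: the YES/NO bridge, padding to a square basis, reindexing

Topic `Algebra/EuclideanLattices`, namespace `Literature.Algebra.EuclideanLattices`. Fourth brick
of the decomposition of `Literature.Algebra.EuclideanLattices.gapSVP_const_isNPHardRandomized`
(pqc.S17) through `Khot2005_SAT_randReducible_gapSVP` (see `KhotSVPHardness.lean`,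
`KhotTensorBoost.lean`, `KhotBasicReduction.lean`). Khot's reduction (J. ACM 52 (2005)) produces
INTEGER bases `B ∈ ℤ^{M×N}` with independent columns, `M ≥ N` (§1.3: "`B` is a `M × N` real
matrix whose columns are linearly independent"), and the boosting lemmas deliver integer bounds
"some nonzero `Bx` has `‖Bx‖² ≤ Y`" / "every nonzero `Bx` has `‖Bx‖² ≥ b`"
(`Khot.boosted_gap`), whereas the tree's `GapSVP.yes/no` (`Problems.lean`) are about SQUARE
nonsingular integer bases in row convention with a rational threshold and the real `λ₁`
(`minNorm`). This file PROVES the three pieces of glue (all standard; reading convention 1 of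
`KhotSVPHardness.lean`, realised by padding instead of orthogonal completion):

* `columnInstance A` — the `LatticeInstance` of a square integer matrix read by columns
  (`basis = Aᵀ`), with `columnInstance_mem_gapSVP_yes` (an integer vector `Au ≠ 0` with
  `‖Au‖² ≤ τ²` puts `(L(A), τ)` in `GapSVP.yes`) and `columnInstance_mem_gapSVP_no` (integer
  lower bound `b` on all nonzero `‖Au‖²` with `(γ(N)τ)² < b` puts it in `GapSVP.no γ`), and
  nonsingularity from independent columns (`det_ne_zero_of_mulVec_eq_zero`, `ℤ` a domain).
* `padCols A₀ K p` — the columns of a non-square `A₀ ∈ ℤ^{R×C}` together with `K·e_r` for the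
  rows `r` in a padded set `p`; if the coefficients are RECOVERABLE from the unpadded rows with
  linear distortion (`Recoverable`; for Khot's matrices: back-substitution through their identity
  blocks, a later brick) then the padded basis has independent columns
  (`padCols_mulVec_eq_zero`), contains `L(A₀)` (`padCols_mulVec_inl`, YES transfer) and, for
  `K` beyond an explicit polynomial threshold, inherits the NO lower bound
  (`le_intSqNorm_padCols`).
* `squareOf M eR eC` — reindexing along bijections `R ≃ Fin N`, `C' ≃ Fin N` to a square
  `Fin N × Fin N` matrix, preserving independence and the YES/NO data (`squareOf_mulVec_eq_zero`,
  `squareOf_yes`, `squareOf_no`).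

Why padding and not `L(A₀) + Kℤ^R`: the latter does not preserve NO instances (`L = ℤ·(1, K)`
has `λ₁ = √(1+K²)` but `L + Kℤ²` contains `(1, 0)`); padding only a complementary set of rows
and recovering the coefficients from the others gives `‖v‖_∞ > T` for every vector using a
padded column, for `K > T + growth·c₁·T`.

## References

* S. Khot, *Hardness of approximating the shortest vector problem in lattices*, J. ACM 52 (2005)
  789–808, §1.3 (bases with independent columns), §7.3 (the gap instance).
* D. Micciancio, S. Goldwasser, *Complexity of Lattice Problems*, Kluwer 2002, Ch. 1 §1.2
  (`GapSVP_γ`; bases and `λ₁`).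
-/

noncomputable section

namespace Literature.Algebra.EuclideanLattices

open Matrix Finset

/-! ### Square integer column bases as `GapSVP` instances -/

section ColumnInstance

variable {N : ℕ}

/-- The `LatticeInstance` (row convention of `IntegerBases.lean`: the ROWS of `basis` generate
the lattice) of a square integer matrix `A ∈ ℤ^{N×N}` read in Khot's COLUMN convention
`L(A) = {Au | u ∈ ℤᴺ}` (§1.3): its basis matrix is `Aᵀ`. [cite: Khot2005, §1.3] -/
abbrev columnInstance (A : Matrix (Fin N) (Fin N) ℤ) : LatticeInstance :=
  ⟨N, Aᵀ⟩

/-- The dimension of `columnInstance A` is `N`. [cite: Khot2005, §1.3] -/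
@[simp] theorem columnInstance_n (A : Matrix (Fin N) (Fin N) ℤ) : (columnInstance A).n = N := rfl

/-- The lattice vector with coefficients `u` is `Au` (viewed in `ℝᴺ`). [cite: Khot2005, §1.3] -/
theorem columnInstance_ofCoeffs (A : Matrix (Fin N) (Fin N) ℤ) (u : Fin N → ℤ) :
    (columnInstance A).ofCoeffs u = intVecToEuclidean N (A *ᵥ u) := by
  show intVecToEuclidean N (u ᵥ* Aᵀ) = _
  rw [Matrix.vecMul_transpose]

/-- Membership in `L(A)`: `x ∈ L(A) ↔ x = Au` for some `u ∈ ℤᴺ`. [cite: Khot2005, §1.3] -/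
theorem mem_lattice_columnInstance_iff (A : Matrix (Fin N) (Fin N) ℤ)
    (x : EuclideanSpace ℝ (Fin N)) :
    x ∈ (columnInstance A).lattice ↔ ∃ u : Fin N → ℤ, intVecToEuclidean N (A *ᵥ u) = x := by
  rw [LatticeInstance.mem_lattice_iff]
  simp only [columnInstance_ofCoeffs]

/-- `columnInstance A` is nonsingular iff `det A ≠ 0`. [cite: Khot2005, §1.3] -/
theorem isNonsingular_columnInstance_iff (A : Matrix (Fin N) (Fin N) ℤ) :
    (columnInstance A).IsNonsingular ↔ A.det ≠ 0 := by
  show Aᵀ.det ≠ 0 ↔ _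
  rw [Matrix.det_transpose]

/-- A square integer matrix with independent columns (`Au = 0 → u = 0`) is nonsingular
(`ℤ` is a domain: Mathlib `Matrix.exists_mulVec_eq_zero_iff`). [folklore] -/
theorem det_ne_zero_of_mulVec_eq_zero {A : Matrix (Fin N) (Fin N) ℤ}
    (hA : ∀ u, A *ᵥ u = 0 → u = 0) : A.det ≠ 0 := by
  intro hdet
  obtain ⟨v, hv, hAv⟩ := Matrix.exists_mulVec_eq_zero_iff.2 hdet
  exact hv (hA v hAv)

/-- **YES bridge.** If `Au ≠ 0` has integer squared norm at most `τ²` (`τ > 0` rational), and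
the columns of `A` are independent, then `(L(A), τ)` is a YES instance of `GapSVP_γ`:
`λ₁(L(A)) ≤ ‖Au‖ ≤ τ`. [cite: MicciancioGoldwasser2002, Ch. 1 §1.2] -/
theorem columnInstance_mem_gapSVP_yes (γ : ℕ → ℝ) {A : Matrix (Fin N) (Fin N) ℤ}
    (hA : ∀ u, A *ᵥ u = 0 → u = 0) {τ : ℚ} (hτ : 0 < τ) {u : Fin N → ℤ} (hu : A *ᵥ u ≠ 0)
    (hle : (intSqNorm (A *ᵥ u) : ℝ) ≤ (τ : ℝ) ^ 2) :
    (columnInstance A, τ) ∈ GapSVP.yes γ := by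
  refine ⟨(isNonsingular_columnInstance_iff A).2 (det_ne_zero_of_mulVec_eq_zero hA), hτ, ?_⟩
  have hmem : intVecToEuclidean N (A *ᵥ u) ∈ (columnInstance A).lattice :=
    (mem_lattice_columnInstance_iff A _).2 ⟨u, rfl⟩
  have hne : intVecToEuclidean N (A *ᵥ u) ≠ 0 := fun h =>
    hu (intVecToEuclidean_injective N (h.trans (map_zero _).symm))
  refine (minNorm_le_norm_of_mem hmem hne).trans ?_
  have hτ' : (0 : ℝ) ≤ τ := by exact_mod_cast hτ.le
  rw [← norm_intVecToEuclidean_sq] at hle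
  calc ‖intVecToEuclidean N (A *ᵥ u)‖ = Real.sqrt (‖intVecToEuclidean N (A *ᵥ u)‖ ^ 2) :=
        (Real.sqrt_sq (norm_nonneg _)).symm
    _ ≤ Real.sqrt ((τ : ℝ) ^ 2) := Real.sqrt_le_sqrt hle
    _ = τ := Real.sqrt_sq hτ'

/-- **NO bridge.** If every `Au` with `u ≠ 0` has integer squared norm at least `b`, the columns
of `A` are independent, `N ≥ 1`, and `(γ(N) · τ)² < b` with `γ(N) ≥ 0`, `τ > 0`, then
`(L(A), τ)` is a NO instance of `GapSVP_γ`: `λ₁(L(A)) ≥ √b > γ(N) τ`.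
[cite: MicciancioGoldwasser2002, Ch. 1 §1.2] -/
theorem columnInstance_mem_gapSVP_no {γ : ℕ → ℝ} {A : Matrix (Fin N) (Fin N) ℤ} (hN : 0 < N)
    (hA : ∀ u, A *ᵥ u = 0 → u = 0) {τ : ℚ} (hτ : 0 < τ) {b : ℤ}
    (hb : ∀ u : Fin N → ℤ, u ≠ 0 → b ≤ intSqNorm (A *ᵥ u)) (hγ : 0 ≤ γ N)
    (hlt : (γ N * τ) ^ 2 < (b : ℝ)) :
    (columnInstance A, τ) ∈ GapSVP.no γ := by
  refine ⟨(isNonsingular_columnInstance_iff A).2 (det_ne_zero_of_mulVec_eq_zero hA), hτ, ?_⟩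
  show γ N * (τ : ℝ) < minNorm (columnInstance A).lattice
  have hγτ : 0 ≤ γ N * τ := mul_nonneg hγ (by exact_mod_cast hτ.le)
  have hsqrt : γ N * τ < Real.sqrt b := (Real.lt_sqrt hγτ).2 hlt
  refine hsqrt.trans_le (le_csInf ?_ ?_)
  · -- the set of norms of nonzero lattice vectors is nonempty (`A e₀ ≠ 0`)
    let e : Fin N → ℤ := Pi.single ⟨0, hN⟩ 1
    have he : e ≠ 0 := by
      intro h
      have := congrFun h ⟨0, hN⟩
      simp [e] at this
    have hAe : A *ᵥ e ≠ 0 := fun h => he (hA e h)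
    refine ⟨‖intVecToEuclidean N (A *ᵥ e)‖, intVecToEuclidean N (A *ᵥ e), ⟨?_, ?_⟩, rfl⟩
    · exact (mem_lattice_columnInstance_iff A _).2 ⟨e, rfl⟩
    · exact fun h => hAe (intVecToEuclidean_injective N (h.trans (map_zero _).symm))
  · rintro _ ⟨x, ⟨hx, hx0⟩, rfl⟩
    obtain ⟨u, rfl⟩ := (mem_lattice_columnInstance_iff A x).1 hx
    have hu : u ≠ 0 := by
      rintro rfl
      exact hx0 (by rw [Matrix.mulVec_zero]; exact map_zero _)
    have hb' : (b : ℝ) ≤ ‖intVecToEuclidean N (A *ᵥ u)‖ ^ 2 := by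
      rw [norm_intVecToEuclidean_sq]
      exact_mod_cast hb u hu
    exact (Real.sqrt_le_sqrt hb').trans_eq (Real.sqrt_sq (norm_nonneg _))

end ColumnInstance

/-! ### Padding an injective integer basis to a square one (replaces orthogonal completion) -/

section Padding

variable {R C : Type} [Fintype R] [Fintype C] [DecidableEq R]

/-- The PADDED basis: the columns of `A₀ ∈ ℤ^{R×C}` together with the columns `K·e_r` for the
rows `r` in the padded set `p` (a decidable predicate on `R`). With `|C| + |p| = |R|` and
recoverability of the coefficients from the unpadded rows this is a square nonsingular basis
whose lattice `L(A₀) + K·ℤ^p` has the same YES/NO behaviour as `L(A₀)` for `K` large.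
(Standard device replacing the orthogonal completion of a non-square basis; not in the source,
which works with `M × N` bases, §1.3.) [folklore] -/
def padCols (A₀ : Matrix R C ℤ) (K : ℤ) (p : R → Prop) [DecidablePred p] :
    Matrix R (C ⊕ {r // p r}) ℤ :=
  Matrix.fromCols A₀ (Matrix.of fun r i => if r = i.1 then K else 0)

/-- `padCols A₀ K p (x ∘ w) = A₀x + K·w` (with `w` extended by `0` off `p`). [folklore] -/
theorem padCols_mulVec (A₀ : Matrix R C ℤ) (K : ℤ) (p : R → Prop) [DecidablePred p]
    (x : C → ℤ) (w : {r // p r} → ℤ) (r : R) :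
    (padCols A₀ K p *ᵥ Sum.elim x w) r =
      (A₀ *ᵥ x) r + if h : p r then K * w ⟨r, h⟩ else 0 := by
  rw [padCols, Matrix.fromCols_mulVec]
  simp only [Sum.elim_comp_inl, Sum.elim_comp_inr, Pi.add_apply, add_right_inj]
  simp only [Matrix.mulVec, dotProduct, Matrix.of_apply, ite_mul, zero_mul]
  by_cases h : p r
  · rw [dif_pos h, Finset.sum_eq_single ⟨r, h⟩]
    · simp
    · rintro ⟨r', h'⟩ - hne
      rw [if_neg]
      exact fun hrr => hne (Subtype.ext hrr.symm)
    · simp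
  · rw [dif_neg h]
    refine Finset.sum_eq_zero fun i _ => ?_
    rw [if_neg]
    rintro rfl
    exact h i.2

/-- **Recoverability** of the coefficients from the UNPADDED rows, with linear distortion `c₁`:
if all unpadded coordinates of `A₀x` have magnitude `≤ t` then all coefficients have magnitude
`≤ c₁ t`. (For Khot's matrices: back-substitution through the identity blocks.) [folklore] -/
def Recoverable (A₀ : Matrix R C ℤ) (p : R → Prop) (c₁ : ℤ) : Prop :=
  ∀ (x : C → ℤ) (t : ℤ), (∀ r, ¬p r → |(A₀ *ᵥ x) r| ≤ t) → ∀ c, |x c| ≤ c₁ * t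

omit [Fintype R] [DecidableEq R] in
/-- Growth of an integer matrix in the sup norm: `|(A₀x)_r| ≤ (∑_c |A₀ r c|) · max_c |x_c|`.
[folklore] -/
theorem abs_mulVec_le (A₀ : Matrix R C ℤ) (x : C → ℤ) {t : ℤ} (ht : ∀ c, |x c| ≤ t) (r : R) :
    |(A₀ *ᵥ x) r| ≤ (∑ c, |A₀ r c|) * t := by
  simp only [Matrix.mulVec, dotProduct]
  calc |∑ c, A₀ r c * x c| ≤ ∑ c, |A₀ r c * x c| := Finset.abs_sum_le_sum_abs _ _
    _ = ∑ c, |A₀ r c| * |x c| := by simp_rw [abs_mul]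
    _ ≤ ∑ c, |A₀ r c| * t := Finset.sum_le_sum fun c _ => mul_le_mul_of_nonneg_left (ht c) (abs_nonneg _)
    _ = (∑ c, |A₀ r c|) * t := by rw [Finset.sum_mul]

/-- The maximal row `ℓ₁`-norm `c₂ = max_r ∑_c |A₀ r c|` bounds the growth uniformly; we use the
sum over all rows as a crude uniform bound. [folklore] -/
def growth (A₀ : Matrix R C ℤ) : ℤ :=
  ∑ r, ∑ c, |A₀ r c|

omit [DecidableEq R] in
/-- `|(A₀x)_r| ≤ growth A₀ · t` whenever `|x_c| ≤ t` for all `c` (and `t ≥ 0`). [folklore] -/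
theorem abs_mulVec_le_growth (A₀ : Matrix R C ℤ) (x : C → ℤ) {t : ℤ} (ht0 : 0 ≤ t)
    (ht : ∀ c, |x c| ≤ t) (r : R) : |(A₀ *ᵥ x) r| ≤ growth A₀ * t := by
  refine (abs_mulVec_le A₀ x ht r).trans (mul_le_mul_of_nonneg_right ?_ ht0)
  exact Finset.single_le_sum (f := fun r => ∑ c, |A₀ r c|)
    (fun r _ => Finset.sum_nonneg fun c _ => abs_nonneg _) (Finset.mem_univ r)

/-- **Injectivity of the padded basis**: recoverable `A₀` and `K ≠ 0` give independent columns.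
[folklore] -/
theorem padCols_mulVec_eq_zero {A₀ : Matrix R C ℤ} {p : R → Prop} [DecidablePred p] {c₁ : ℤ}
    (hrec : Recoverable A₀ p c₁) {K : ℤ} (hK : K ≠ 0) (v : C ⊕ {r // p r} → ℤ)
    (hv : padCols A₀ K p *ᵥ v = 0) : v = 0 := by
  have hv' : v = Sum.elim (v ∘ Sum.inl) (v ∘ Sum.inr) := by
    funext i; rcases i with i | i <;> rfl
  rw [hv'] at hv ⊢
  set x := v ∘ Sum.inl
  set w := v ∘ Sum.inr
  have hx : x = 0 := by
    funext c
    have h := hrec x 0 (fun r hr => by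
      have := congrFun hv r
      rw [padCols_mulVec, dif_neg hr, add_zero] at this
      rw [this]; simp) c
    simpa using h
  have hw : w = 0 := by
    funext ⟨r, hr⟩
    have := congrFun hv r
    rw [padCols_mulVec, dif_pos hr, hx, Matrix.mulVec_zero, Pi.zero_apply, zero_add] at this
    exact (mul_eq_zero.1 this).resolve_left hK
  rw [hx, hw]
  funext i; rcases i with i | i <;> rfl

/-- **YES transfer**: the padded lattice contains `L(A₀)`, `padCols A₀ K p (x ∘ 0) = A₀x`.
[folklore] -/
theorem padCols_mulVec_inl (A₀ : Matrix R C ℤ) (K : ℤ) (p : R → Prop) [DecidablePred p]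
    (x : C → ℤ) : padCols A₀ K p *ᵥ Sum.elim x 0 = A₀ *ᵥ x := by
  funext r
  rw [padCols_mulVec]
  by_cases h : p r
  · rw [dif_pos h]; simp
  · rw [dif_neg h, add_zero]

/-- **NO transfer for the padded basis.** Suppose every nonzero `A₀x` has squared norm `≥ b`,
`A₀` is recoverable from the unpadded rows with distortion `c₁ ≥ 0`, and `K` exceeds
`T + growth(A₀)·c₁·T` for a threshold `T ≥ 0` with `b ≤ (T+1)²`. Then every nonzero vector of
the padded lattice has squared norm `≥ b`: either `w = 0` and the vector is `A₀x ≠ 0`; or some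
coordinate exceeds `T` in magnitude (contributing `≥ (T+1)² ≥ b`); or all coordinates are
`≤ T`, the coefficients are `≤ c₁T`, all of `A₀x` is `≤ growth·c₁·T`, and a padded row with
`w_r ≠ 0` carries `|(A₀x)_r + K w_r| ≥ K - growth·c₁·T > T`, a contradiction. [folklore] -/
theorem le_intSqNorm_padCols {A₀ : Matrix R C ℤ} {p : R → Prop} [DecidablePred p] {b c₁ : ℤ}
    (hb : ∀ x : C → ℤ, x ≠ 0 → b ≤ intSqNorm (A₀ *ᵥ x)) (hrec : Recoverable A₀ p c₁)
    (hc₁ : 0 ≤ c₁) {K T : ℤ} (hT : 0 ≤ T) (hbT : b ≤ (T + 1) ^ 2)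
    (hK : T + growth A₀ * (c₁ * T) < K) (v : C ⊕ {r // p r} → ℤ) (hv : v ≠ 0) :
    b ≤ intSqNorm (padCols A₀ K p *ᵥ v) := by
  have hv' : v = Sum.elim (v ∘ Sum.inl) (v ∘ Sum.inr) := by
    funext i; rcases i with i | i <;> rfl
  rw [hv'] at hv ⊢
  set x := v ∘ Sum.inl
  set w := v ∘ Sum.inr
  by_cases hw : w = 0
  · -- `w = 0`: the vector is `A₀x` with `x ≠ 0`
    have hx : x ≠ 0 := by
      intro hx; apply hv; rw [hx, hw]; funext i; rcases i with i | i <;> rfl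
    rw [hw, padCols_mulVec_inl]
    exact hb x hx
  -- `w ≠ 0`
  by_cases hbig : ∃ r, T < |(padCols A₀ K p *ᵥ Sum.elim x w) r|
  · obtain ⟨r, hr⟩ := hbig
    have h1 : (T + 1) ^ 2 ≤ (padCols A₀ K p *ᵥ Sum.elim x w) r ^ 2 := by
      rw [← sq_abs ((padCols A₀ K p *ᵥ Sum.elim x w) r)]
      exact pow_le_pow_left₀ (by omega) (by omega) 2
    exact hbT.trans (h1.trans (sq_le_intSqNorm _ r))
  push Not at hbig
  exfalso
  -- all coordinates `≤ T`: recover the coefficients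
  have hxT : ∀ c, |x c| ≤ c₁ * T := hrec x T fun r hr => by
    have := hbig r
    rwa [padCols_mulVec, dif_neg hr, add_zero] at this
  have hAx : ∀ r, |(A₀ *ᵥ x) r| ≤ growth A₀ * (c₁ * T) :=
    abs_mulVec_le_growth A₀ x (mul_nonneg hc₁ hT) hxT
  obtain ⟨⟨r, hr⟩, hwr⟩ := Function.ne_iff.1 hw
  have hcoord := hbig r
  rw [padCols_mulVec, dif_pos hr] at hcoord
  have hKw : |K| ≤ |K * w ⟨r, hr⟩| := by
    rw [abs_mul]
    exact le_mul_of_one_le_right (abs_nonneg K) (Int.one_le_abs hwr)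
  have hg0 : 0 ≤ growth A₀ :=
    Finset.sum_nonneg fun r _ => Finset.sum_nonneg fun c _ => abs_nonneg (A₀ r c)
  have hK0 : 0 ≤ K := by
    have := mul_nonneg hg0 (mul_nonneg hc₁ hT)
    linarith
  rw [abs_of_nonneg hK0] at hKw
  -- `|a + Kw| ≥ |Kw| - |a| ≥ K - growth·c₁·T > T`
  have htri : |K * w ⟨r, hr⟩| - |(A₀ *ᵥ x) r| ≤ |(A₀ *ᵥ x) r + K * w ⟨r, hr⟩| := by
    have := abs_sub_abs_le_abs_sub (K * w ⟨r, hr⟩) (-(A₀ *ᵥ x) r)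
    rw [abs_neg, sub_neg_eq_add, add_comm] at this
    exact this
  have := hAx r
  linarith

end Padding

/-! ### Reindexing to a square `Fin N × Fin N` basis -/

section Square

variable {R C' : Type} [Fintype C'] {N : ℕ}

/-- Reindex an integer matrix whose row and column types both have `N` elements to a square
`Fin N × Fin N` matrix (Mathlib `Matrix.reindex`); lattice vectors are permuted coordinatewise,
so all norms and the YES/NO data are unchanged. [folklore] -/
def squareOf (M : Matrix R C' ℤ) (eR : R ≃ Fin N) (eC : C' ≃ Fin N) : Matrix (Fin N) (Fin N) ℤ :=
  Matrix.reindex eR eC M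

/-- `squareOf M eR eC u = (M (u ∘ eC)) ∘ eR⁻¹`. [folklore] -/
theorem squareOf_mulVec (M : Matrix R C' ℤ) (eR : R ≃ Fin N) (eC : C' ≃ Fin N) (u : Fin N → ℤ) :
    squareOf M eR eC *ᵥ u = (M *ᵥ (u ∘ eC)) ∘ eR.symm := by
  rw [squareOf, Matrix.reindex_apply, Matrix.submatrix_mulVec_equiv]
  rfl

omit [Fintype C'] in
/-- The integer squared norm is invariant under a permutation of the coordinates. [folklore] -/
theorem intSqNorm_comp_equiv [Fintype R] (v : R → ℤ) (e : Fin N ≃ R) : intSqNorm (v ∘ e) = intSqNorm v := by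
  unfold intSqNorm
  exact Fintype.sum_equiv e _ _ fun _ => rfl

/-- Independent columns are preserved by reindexing. [folklore] -/
theorem squareOf_mulVec_eq_zero {M : Matrix R C' ℤ} (hM : ∀ v, M *ᵥ v = 0 → v = 0)
    (eR : R ≃ Fin N) (eC : C' ≃ Fin N) (u : Fin N → ℤ) (hu : squareOf M eR eC *ᵥ u = 0) :
    u = 0 := by
  rw [squareOf_mulVec] at hu
  have h1 : M *ᵥ (u ∘ eC) = 0 := by
    funext r
    have := congrFun hu (eR r)
    simpa using this
  have h2 := hM _ h1
  funext i
  have := congrFun h2 (eC.symm i)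
  simpa using this

/-- YES data is preserved by reindexing: the vector with coefficients `v ∘ eC⁻¹` is `Mv`
permuted. [folklore] -/
theorem squareOf_mulVec_symm (M : Matrix R C' ℤ) (eR : R ≃ Fin N) (eC : C' ≃ Fin N)
    (v : C' → ℤ) : squareOf M eR eC *ᵥ (v ∘ eC.symm) = (M *ᵥ v) ∘ eR.symm := by
  rw [squareOf_mulVec]
  congr 2
  funext c
  simp

/-- YES data transfers to the square matrix. [folklore] -/
theorem squareOf_yes [Fintype R] (M : Matrix R C' ℤ) (eR : R ≃ Fin N) (eC : C' ≃ Fin N) {v : C' → ℤ}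
    {g : ℤ} (hv : M *ᵥ v ≠ 0) (hg : intSqNorm (M *ᵥ v) ≤ g) :
    squareOf M eR eC *ᵥ (v ∘ eC.symm) ≠ 0 ∧ intSqNorm (squareOf M eR eC *ᵥ (v ∘ eC.symm)) ≤ g := by
  rw [squareOf_mulVec_symm, intSqNorm_comp_equiv]
  refine ⟨fun h => hv ?_, hg⟩
  funext r
  have := congrFun h (eR r)
  simpa using this

/-- NO data transfers to the square matrix. [folklore] -/
theorem squareOf_no [Fintype R] {M : Matrix R C' ℤ} {b : ℤ} (hb : ∀ v : C' → ℤ, v ≠ 0 → b ≤ intSqNorm (M *ᵥ v))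
    (eR : R ≃ Fin N) (eC : C' ≃ Fin N) (u : Fin N → ℤ) (hu : u ≠ 0) :
    b ≤ intSqNorm (squareOf M eR eC *ᵥ u) := by
  rw [squareOf_mulVec, intSqNorm_comp_equiv]
  refine hb _ fun h => hu ?_
  funext i
  have := congrFun h (eC.symm i)
  simpa using this

end Square

end Literature.Algebra.EuclideanLattices
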